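import Summits.Ventures.GridStability.Models.DroopQVPortHamiltonianSpectrum

/-!
# GridStability/Models/DroopQVPortHamiltonianStrict — the SHARP solver-free theorem of rung G3.b: with a positive definite `𝒬 + c·r rᵀ` every mode of the droop microgrid WITH Q–V voltage dynamics is the rotation zero mode or lies in the OPEN left half-plane

Cell `gridfusion` (LADDER-GRIDFUSION, APEX LINE rung G3.b; seat gridfusion-model-8 (g0); sharpening of the family theorem #68
`DroopMicrogrid.re_eig_nonpos_of_hessQ` of `Models/DroopQVPortHamiltonianSpectrum.lean` (p520805), whose conclusion `Re μ ≤ 0` did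
not exclude imaginary-axis modes — ref-3 W1 on LEDGER-3 row 13). Two steps, both solver-free and valid for every `n`:
* §1 `re_eig_neg_or_dissipationless_of_pH_psd` (generic, [folklore]): `A = (J − R)Q`, `J` skew, `R ⪰ 0`, `Q ⪰ 0`, `A v = μ v`,
  `v ≠ 0` ⇒ `Re μ < 0` OR the mode is DISSIPATIONLESS: `R (Q v) = 0` (for a PSD `R`, `u*Ru = 0` forces `Ru = 0`);
* §2 `DroopMicrogrid.hessQ_map_mulVec`, `phR_map_mulVec` (the blocks of `𝒬` and `ℛ` acting on a complex state vector) and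
  **`DroopMicrogrid.re_eig_neg_or_rotation_of_hessQ`**: for model N1 with `k_P, τ_P, k_Q ≠ 0`, STRICT dissipation weights
  `k_P/τ_P² > 0`, `k_Q V/τ_Q > 0`, `V ≠ 0`, at a state where `𝒬(θ, V)` is symmetric and `𝒬(θ, V) + c·r rᵀ ≻ 0` for the rotation
  vector `r = [1; 0; 0]` and some real `c`: every complex eigenpair `(μ, v)` of `jacMatrix (θ, V)` has `Re μ < 0`, OR `μ = 0` and
  `v` is a complex multiple of `r` (the rotation mode). Mechanism: a dissipationless mode has `(𝒬v)_ω = (𝒬v)_V = 0`, hence (ω-row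
  of `𝒬`) `v_ω = 0`; the Jacobian rows then give `μ v_θ = 0`, `μ v_V = 0`, so `μ ≠ 0` would force `v = 0`; and `μ = 0` forces
  `𝒬 v = 0`, whence `v ∥ r` by definiteness of `𝒬 + c r rᵀ`. So the `3n × 3n` linearisation is HURWITZ ON THE ROTATION QUOTIENT
  from ONE positive definite certificate — no Lyapunov solve, no rate (rates remain the point lane's business).
THREE COLUMNS. CERTIFIED (kernel): matrix statement about the MODEL N1, any `n`; per-instance input = one PD fact (the direct integer
Gram certificates of `Models/WSCC9DroopQVHessian.lean` / the K2A twin qualify; the rounded-twin lane gives only `⪰ 0` and hence only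
§1's dichotomy). MODELLED: «MV-6D network version (KunduEtAl2019 (4a)–(4c), τ-filtered droop with Q–V)»; structure theorem, no instance;
kernel form of the linear-algebraic content behind [cite: ShinZavala2020, Prop. 1] (its LaSalle step is replaced by the spectral
dichotomy). VALIDATED: nothing. No sentence of this file says a converter or a microgrid is stable.
-/

noncomputable section

open Real Matrix Finset
open scoped ComplexOrder ComplexConjugate

namespace Summit.Ventures.GridStability.Models

/-! ## §1 The dissipation dichotomy for `A = (J − R)Q` -/

section PH

variable {ι : Type*} [Fintype ι] [DecidableEq ι]

/-- **Dissipation dichotomy.** `A = (J − R) Q` with `J` real skew, `R ⪰ 0`, `Q ⪰ 0`; every complex solution of `A v = μ v`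
has `Re μ < 0` or is dissipationless, `R (Q v) = 0` (then `μ` need not leave the imaginary axis). [folklore] -/
theorem re_eig_neg_or_dissipationless_of_pH_psd {J R Q : Matrix ι ι ℝ} (hJ : Jᵀ = -J) (hR : R.PosSemidef)
    (hQ : Q.PosSemidef) {μ : ℂ} {v : ι → ℂ}
    (hAv : ((J - R) * Q).map ((↑) : ℝ → ℂ) *ᵥ v = μ • v) :
    μ.re < 0 ∨ R.map ((↑) : ℝ → ℂ) *ᵥ (Q.map ((↑) : ℝ → ℂ) *ᵥ v) = 0 := by
  have hQs : Qᵀ = Q := by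
    have h := hQ.isHermitian
    rw [Matrix.IsHermitian, Matrix.conjTranspose_eq_transpose_of_trivial] at h
    exact h
  set u : ι → ℂ := Q.map ((↑) : ℝ → ℂ) *ᵥ v with hudef
  have hRC := posSemidef_map_ofReal hR
  by_cases hRu : R.map ((↑) : ℝ → ℂ) *ᵥ u = 0
  · exact Or.inr hRu
  left
  set q : ℂ := star v ⬝ᵥ u with hqdef
  have hmul : ((J - R) * Q).map ((↑) : ℝ → ℂ) *ᵥ v = (J - R).map ((↑) : ℝ → ℂ) *ᵥ u := by
    rw [hudef, Matrix.mulVec_mulVec]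
    congr 1
    ext a b
    simp only [Matrix.map_apply, Matrix.mul_apply]
    push_cast
    rfl
  have hQC := posSemidef_map_ofReal hQ
  have hu : u ≠ 0 := by
    intro h0; apply hRu; rw [h0, Matrix.mulVec_zero]
  have hq0 : 0 ≤ q := hQC.dotProduct_mulVec_nonneg v
  have hqne : q ≠ 0 := fun h0 => hu ((hQC.dotProduct_mulVec_zero_iff v).1 h0)
  have hqpos : 0 < q := lt_of_le_of_ne hq0 (Ne.symm hqne)
  obtain ⟨hqre, hqim⟩ := Complex.pos_iff.1 hqpos
  have hkey : μ * q = star u ⬝ᵥ ((J - R).map ((↑) : ℝ → ℂ) *ᵥ u) := by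
    have h1 : star v ⬝ᵥ (Q.map ((↑) : ℝ → ℂ) *ᵥ (((J - R) * Q).map ((↑) : ℝ → ℂ) *ᵥ v)) = μ * q := by
      rw [hAv, Matrix.mulVec_smul, dotProduct_smul, smul_eq_mul]
    rw [← h1, star_dotProduct_map_mulVec_symm hQs, ← hudef, hmul]
  have hsplit : (J - R).map ((↑) : ℝ → ℂ) = J.map ((↑) : ℝ → ℂ) - R.map ((↑) : ℝ → ℂ) := by
    ext a b; simp
  rw [hsplit, Matrix.sub_mulVec, dotProduct_sub] at hkey
  have hJ0 := re_star_dotProduct_skew_eq_zero hJ u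
  have hRpos : 0 < star u ⬝ᵥ (R.map ((↑) : ℝ → ℂ) *ᵥ u) := by
    rcases (hRC.dotProduct_mulVec_nonneg u).lt_or_eq with h | h
    · exact h
    · exact absurd ((hRC.dotProduct_mulVec_zero_iff u).1 h.symm) hRu
  obtain ⟨hRre, -⟩ := Complex.pos_iff.1 hRpos
  have hre := congr_arg Complex.re hkey
  have hqC : q = (q.re : ℂ) := Complex.ext (by simp) (by simp [← hqim])
  rw [hqC, Complex.sub_re, hJ0] at hre
  simp only [Complex.mul_re, Complex.ofReal_re, Complex.ofReal_im, mul_zero, sub_zero] at hre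
  nlinarith

omit [DecidableEq ι] in
/-- A real positive definite matrix acts injectively on complex vectors. [folklore] -/
theorem map_ofReal_mulVec_eq_zero_of_posDef {P : Matrix ι ι ℝ} (hP : P.PosDef) {w : ι → ℂ}
    (hw : P.map ((↑) : ℝ → ℂ) *ᵥ w = 0) : w = 0 := by
  classical
  refine Matrix.eq_zero_of_mulVec_eq_zero ?_ hw
  have hdet : P.det ≠ 0 := hP.det_pos.ne'
  have : (P.map ((↑) : ℝ → ℂ)).det = ((P.det : ℝ) : ℂ) := by
    have h := (RingHom.map_det Complex.ofRealHom P).symm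
    exact h
  rw [this]
  exact_mod_cast hdet

end PH

/-! ## §2 The droop microgrid: dissipationless modes are the rotation mode -/

namespace DroopMicrogrid

variable {n : ℕ} (mg : DroopMicrogrid n)

/-- `𝒬(θ, V)` acting on a complex state vector `[x; w; e]`, block row by block row. [folklore] -/
theorem hessQ_map_mulVec (θ V : Fin n → ℝ) (x w e : Fin n → ℂ) :
    (mg.hessQ θ V).map ((↑) : ℝ → ℂ) *ᵥ Sum.elim x (Sum.elim w e) =
      Sum.elim ((mg.Pθ θ V).map ((↑) : ℝ → ℂ) *ᵥ x + (mg.PV θ V).map ((↑) : ℝ → ℂ) *ᵥ e) (Sum.elim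
        (fun i => ((mg.τP i / mg.kP i : ℝ) : ℂ) * w i)
        (fun i => ((V i)⁻¹ : ℝ) * (((mg.Qθ θ V).map ((↑) : ℝ → ℂ) *ᵥ x) i
          + (((mg.QV θ V).map ((↑) : ℝ → ℂ) *ᵥ e) i + ((mg.kQ i)⁻¹ : ℝ) * e i)))) := by
  rw [hessQ, block3, Matrix.fromBlocks_map, Matrix.fromCols_map, Matrix.fromRows_map, Matrix.fromBlocks_map,
    Matrix.map_zero _ Complex.ofReal_zero, Matrix.fromBlocks_mulVec, Matrix.fromBlocks_mulVec, Matrix.fromRows_mulVec,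
    Matrix.fromCols_mulVec]
  simp only [Sum.elim_comp_inl, Sum.elim_comp_inr, Matrix.zero_mulVec, zero_add, add_zero]
  funext k
  rcases k with i | i | i
  · simp
  · simp only [Pi.add_apply, Sum.elim_inr, Sum.elim_inl, Pi.zero_apply, zero_add, map_ofReal_diagonal_mulVec]
  · simp only [Pi.add_apply, Sum.elim_inr, map_ofReal_diagonal_mul_mulVec]
    rw [Matrix.map_add _ (fun a b => Complex.ofReal_add a b), Matrix.add_mulVec, Pi.add_apply,
      map_ofReal_diagonal_mulVec]
    ring

/-- `ℛ(V)` acting on a complex state vector: `diag(0, k_P/τ_P², k_Q V/τ_Q)`. [folklore] -/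
theorem phR_map_mulVec (V : Fin n → ℝ) (a b c : Fin n → ℂ) :
    (mg.phR V).map ((↑) : ℝ → ℂ) *ᵥ Sum.elim a (Sum.elim b c) =
      Sum.elim (0 : Fin n → ℂ) (Sum.elim (fun i => ((mg.kP i / mg.τP i ^ 2 : ℝ) : ℂ) * b i)
        (fun i => ((mg.kQ i * V i / mg.τQ i : ℝ) : ℂ) * c i)) := by
  rw [phR_eq_diagonal, Matrix.diagonal_map (by simp)]
  funext k
  rw [Matrix.mulVec_diagonal]
  rcases k with i | i | i <;> simp

/-- **THE SHARP SOLVER-FREE THEOREM (any `n`).** Model N1 with `k_Pi, τ_Pi, k_Qi ≠ 0`, STRICT dissipation weights `k_Pi/τ_Pi² > 0`,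
`k_Qi V_i/τ_Qi > 0`, voltages `V_i ≠ 0`; at a state `(θ, V)` where the Hessian pattern `𝒬(θ, V)` is symmetric and `𝒬 + c·r rᵀ` is positive
definite for the rotation vector `r = [1; 0; 0]` and some real `c`: every complex eigenpair `(μ, v)` of `jacMatrix (θ, V)` has `Re μ < 0`,
or `μ = 0` and `v` is a (complex) multiple of `r` — the linearisation is Hurwitz on the rotation quotient. CERTIFIED (matrix statement
about the MODEL); MODELLED: MV-6D network version; [cite: ShinZavala2020, Prop. 1] [cite: KunduEtAl2019, eqs. (4a)–(4c)]. No stability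
sentence. -/
theorem re_eig_neg_or_rotation_of_hessQ (θ V : Fin n → ℝ) (hkP : ∀ i, mg.kP i ≠ 0) (hτP : ∀ i, mg.τP i ≠ 0)
    (hkQ : ∀ i, mg.kQ i ≠ 0) (hV : ∀ i, V i ≠ 0) (hRP : ∀ i, 0 < mg.kP i / mg.τP i ^ 2)
    (hRQ : ∀ i, 0 < mg.kQ i * V i / mg.τQ i) (hsymm : (mg.hessQ θ V)ᵀ = mg.hessQ θ V) {c : ℝ}
    (hP : (mg.hessQ θ V + c • Matrix.vecMulVec (Sum.elim (fun _ => (1 : ℝ)) (Sum.elim 0 0))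
      (Sum.elim (fun _ => (1 : ℝ)) (Sum.elim 0 0))).PosDef)
    {μ : ℂ} {v : Fin n ⊕ (Fin n ⊕ Fin n) → ℂ} (hv : v ≠ 0)
    (hJv : (mg.jacMatrix θ V).map ((↑) : ℝ → ℂ) *ᵥ v = μ • v) :
    μ.re < 0 ∨ (μ = 0 ∧ ∃ a : ℂ, v = fun k => a * ((Sum.elim (fun _ => (1 : ℝ)) (Sum.elim 0 0) k : ℝ) : ℂ)) := by
  set r : Fin n ⊕ (Fin n ⊕ Fin n) → ℝ := Sum.elim (fun _ => (1 : ℝ)) (Sum.elim 0 0) with hrdef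
  have hQpsd : (mg.hessQ θ V).PosSemidef :=
    posSemidef_of_posDef_add_rankOne hsymm (mg.hessQ_mulVec_rotation θ V) hP
  have hJv' := hJv
  rw [mg.jacMatrix_eq_pH θ V hkP hτP hkQ hV] at hJv'
  rcases re_eig_neg_or_dissipationless_of_pH_psd mg.phJ_transpose
      (mg.phR_posSemidef V (fun i => (hRP i).le) (fun i => (hRQ i).le)) hQpsd hJv' with hneg | hR0
  · exact Or.inl hneg
  right
  -- split `v = [x; w; e]`
  set x : Fin n → ℂ := v ∘ Sum.inl with hxdef
  set w : Fin n → ℂ := v ∘ Sum.inr ∘ Sum.inl with hwdef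
  set e : Fin n → ℂ := v ∘ Sum.inr ∘ Sum.inr with hedef
  have hv' : v = Sum.elim x (Sum.elim w e) := by funext k; rcases k with i | i | i <;> rfl
  -- dissipationless: the ω- and V-components of 𝒬 v vanish
  rw [hv', hessQ_map_mulVec, phR_map_mulVec] at hR0
  have hw0 : ∀ i, w i = 0 := by
    intro i
    have h := congr_fun hR0 (Sum.inr (Sum.inl i))
    simp only [Sum.elim_inr, Sum.elim_inl, Pi.zero_apply, mul_eq_zero, Complex.ofReal_eq_zero] at h
    rcases h with h | h
    · exact absurd h (hRP i).ne'
    · rcases h with h | h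
      · exfalso
        have : mg.τP i / mg.kP i ≠ 0 := div_ne_zero (hτP i) (hkP i)
        exact this h
      · exact h
  have hV0 : ∀ i, ((mg.Qθ θ V).map ((↑) : ℝ → ℂ) *ᵥ x) i
      + (((mg.QV θ V).map ((↑) : ℝ → ℂ) *ᵥ e) i + ((mg.kQ i)⁻¹ : ℝ) * e i) = 0 := by
    intro i
    have h := congr_fun hR0 (Sum.inr (Sum.inr i))
    simp only [Sum.elim_inr, Pi.zero_apply, mul_eq_zero, Complex.ofReal_eq_zero] at h
    rcases h with h | h
    · exact absurd h (hRQ i).ne'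
    · rcases h with h | h
      · exact absurd h (inv_ne_zero (hV i))
      · exact h
  -- the Jacobian rows
  rw [hv', jacMatrix_map_mulVec] at hJv
  have hθrow : ∀ i, μ * x i = 0 := by
    intro i
    have h := congr_fun hJv (Sum.inl i)
    simp only [Sum.elim_inl, Pi.smul_apply, smul_eq_mul] at h
    rw [← h, hw0 i]
  have hVrow : ∀ i, μ * e i = 0 := by
    intro i
    have h := congr_fun hJv (Sum.inr (Sum.inr i))
    simp only [Sum.elim_inr, Pi.smul_apply, smul_eq_mul] at h
    -- h : -(ΛQ i * (Qθ x) i) - (e i + kQ i * (QV e) i) / τQ i = μ * e i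
    have hq := hV0 i
    have hΛ : (mg.ΛQ i : ℂ) = ((mg.kQ i : ℝ) : ℂ) / ((mg.τQ i : ℝ) : ℂ) := by
      simp only [ΛQ]; push_cast; rfl
    have hk : ((mg.kQ i : ℝ) : ℂ) ≠ 0 := by exact_mod_cast hkQ i
    rw [← h, hΛ]
    have hQθ : ((mg.Qθ θ V).map ((↑) : ℝ → ℂ) *ᵥ x) i
        = -((((mg.QV θ V).map ((↑) : ℝ → ℂ) *ᵥ e) i + ((mg.kQ i)⁻¹ : ℝ) * e i)) := by
      linear_combination hq
    rw [hQθ]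
    push_cast
    field_simp
    ring
  by_cases hμ : μ = 0
  · refine ⟨hμ, ?_⟩
    -- μ = 0: 𝒬 v = 0, then v ∥ r by definiteness of 𝒬 + c r rᵀ
    have hωrow : ∀ i, ((mg.Pθ θ V).map ((↑) : ℝ → ℂ) *ᵥ x) i + ((mg.PV θ V).map ((↑) : ℝ → ℂ) *ᵥ e) i = 0 := by
      intro i
      have h := congr_fun hJv (Sum.inr (Sum.inl i))
      simp only [Sum.elim_inr, Sum.elim_inl, Pi.smul_apply, smul_eq_mul, hμ, zero_mul, hw0 i, zero_div,
        sub_zero] at h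
      have hΛ : (mg.ΛP i : ℂ) ≠ 0 := by
        have : mg.ΛP i ≠ 0 := div_ne_zero (hkP i) (hτP i)
        exact_mod_cast this
      have h2 : (mg.ΛP i : ℂ) * (((mg.Pθ θ V).map ((↑) : ℝ → ℂ) *ᵥ x) i + ((mg.PV θ V).map ((↑) : ℝ → ℂ) *ᵥ e) i) = 0 := by
        linear_combination -h
      rcases mul_eq_zero.1 h2 with h3 | h3
      · exact absurd h3 hΛ
      · exact h3
    have hQv : (mg.hessQ θ V).map ((↑) : ℝ → ℂ) *ᵥ v = 0 := by
      rw [hv', hessQ_map_mulVec]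
      funext k
      rcases k with i | i | i
      · simpa using hωrow i
      · simp [hw0 i]
      · simp only [Sum.elim_inr, Pi.zero_apply, hV0 i, mul_zero]
    -- (𝒬 + c r rᵀ) (v − a r) = 0 with a = (rᵀv)/(rᵀr)... use injectivity
    set P : Matrix _ _ ℝ := mg.hessQ θ V + c • Matrix.vecMulVec r r with hPdef
    have hPr : ∀ y : Fin n ⊕ (Fin n ⊕ Fin n) → ℂ, P.map ((↑) : ℝ → ℂ) *ᵥ y
        = (mg.hessQ θ V).map ((↑) : ℝ → ℂ) *ᵥ y + ((c : ℂ) * ∑ k, (r k : ℂ) * y k) • fun k => (r k : ℂ) := by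
      intro y
      rw [hPdef, Matrix.map_add _ (fun a b => Complex.ofReal_add a b), Matrix.add_mulVec]
      congr 1
      funext k
      simp only [map_ofReal_mulVec_apply, Matrix.smul_apply, Matrix.vecMulVec_apply, smul_eq_mul, Pi.smul_apply,
        Finset.mul_sum, Finset.sum_mul]
      push_cast
      exact Finset.sum_congr rfl fun j _ => by ring
    have hrr : (∑ k, (r k : ℂ) * (r k : ℂ)) = (n : ℂ) := by
      rw [Fintype.sum_sum_type, Fintype.sum_sum_type]
      simp [hrdef]
    have hQr : (mg.hessQ θ V).map ((↑) : ℝ → ℂ) *ᵥ (fun k => (r k : ℂ)) = 0 := by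
      have h := mg.hessQ_mulVec_rotation θ V
      have : (fun k => (r k : ℂ)) = fun k => ((r k : ℝ) : ℂ) := rfl
      funext k
      rw [map_ofReal_mulVec_apply]
      have hk := congr_fun h k
      simp only [Matrix.mulVec, dotProduct, Pi.zero_apply] at hk
      have : (∑ j, ((mg.hessQ θ V k j : ℝ) : ℂ) * (r j : ℂ)) = (((∑ j, mg.hessQ θ V k j * r j : ℝ)) : ℂ) := by
        push_cast; rfl
      rw [this, hk]; simp
    by_cases hn : n = 0
    · subst hn
      exfalso; apply hv; funext k
      rcases k with i | i | i <;> exact i.elim0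
    have hnC : (n : ℂ) ≠ 0 := by exact_mod_cast hn
    set a : ℂ := (∑ k, (r k : ℂ) * v k) / (n : ℂ) with hadef
    refine ⟨a, ?_⟩
    have h1 : (mg.hessQ θ V).map ((↑) : ℝ → ℂ) *ᵥ (fun k => a * (r k : ℂ))
        = a • ((mg.hessQ θ V).map ((↑) : ℝ → ℂ) *ᵥ fun k => (r k : ℂ)) := by
      rw [← Matrix.mulVec_smul]; rfl
    have h2 : (∑ k, (r k : ℂ) * (a * (r k : ℂ))) = a * (n : ℂ) := by
      rw [← hrr, Finset.mul_sum]
      exact Finset.sum_congr rfl fun k _ => by ring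
    have h3 : a * (n : ℂ) = ∑ k, (r k : ℂ) * v k := by
      rw [hadef]; field_simp
    have hPv : P.map ((↑) : ℝ → ℂ) *ᵥ v = ((c : ℂ) * ∑ k, (r k : ℂ) * v k) • fun k => (r k : ℂ) := by
      rw [hPr, hQv, zero_add]
    have hPar : P.map ((↑) : ℝ → ℂ) *ᵥ (fun k => a * (r k : ℂ)) = ((c : ℂ) * ∑ k, (r k : ℂ) * v k) • fun k => (r k : ℂ) := by
      rw [hPr, h1, hQr, smul_zero, zero_add, h2, h3]
    have hdiff : P.map ((↑) : ℝ → ℂ) *ᵥ (v - fun k => a * (r k : ℂ)) = 0 := by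
      rw [Matrix.mulVec_sub, hPv, hPar, sub_self]
    have h := map_ofReal_mulVec_eq_zero_of_posDef hP hdiff
    funext k
    have hk := congr_fun h k
    simp only [Pi.sub_apply, Pi.zero_apply, sub_eq_zero] at hk
    rw [hk]
  · -- μ ≠ 0 forces v = 0: contradiction
    exfalso
    apply hv
    rw [hv']
    funext k
    rcases k with i | i | i
    · simpa using (mul_eq_zero.1 (hθrow i)).resolve_left hμ
    · exact hw0 i
    · simpa using (mul_eq_zero.1 (hVrow i)).resolve_left hμ

/-! ## §3 (append 2026-08-27, lead g6 RULING 7c) No Jordan chain at the rotation zero: the zero eigenvalue is SIMPLE -/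

/-- **No Jordan chain at `0` (structural, lossless model, any `n ≥ 1`).** Under the factorisation hypotheses (`k_P, τ_P, k_Q ≠ 0`,
`V_i ≠ 0`), STRICT dissipation weights `k_P/τ_P² > 0`, `k_Q V/τ_Q > 0` and a symmetric Hessian pattern `𝒬(θ, V)`, NO complex vector `w`
solves `jacMatrix (θ, V) w = r` (`r = [1; 0; 0]` the rotation vector): with `u = 𝒬 w`, `(𝒬w)*r = w*(𝒬 r) = 0` and `Re u*𝒥u = 0` force
`u*ℛu = 0`, hence `u_ω = u_V = 0`, hence the angle block of `(𝒥 − ℛ)u` vanishes — but it should be `1`. So `ker J² = ker J`: together with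
`ker J = ℂ·r` (`re_eig_neg_or_rotation_of_hessQ`) the eigenvalue `0` is ALGEBRAICALLY simple. No certificate is needed for this step.
[folklore] -/
theorem no_jordan_chain_at_zero_of_hessQ (θ V : Fin n → ℝ) (hkP : ∀ i, mg.kP i ≠ 0) (hτP : ∀ i, mg.τP i ≠ 0)
    (hkQ : ∀ i, mg.kQ i ≠ 0) (hV : ∀ i, V i ≠ 0) (hRP : ∀ i, 0 < mg.kP i / mg.τP i ^ 2)
    (hRQ : ∀ i, 0 < mg.kQ i * V i / mg.τQ i) (hsymm : (mg.hessQ θ V)ᵀ = mg.hessQ θ V) (i₀ : Fin n)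
    {w : Fin n ⊕ (Fin n ⊕ Fin n) → ℂ}
    (hw : (mg.jacMatrix θ V).map ((↑) : ℝ → ℂ) *ᵥ w = fun k => ((Sum.elim (fun _ => (1 : ℝ)) (Sum.elim 0 0) k : ℝ) : ℂ)) :
    False := by
  set r : Fin n ⊕ (Fin n ⊕ Fin n) → ℝ := Sum.elim (fun _ => (1 : ℝ)) (Sum.elim 0 0) with hrdef
  set u : Fin n ⊕ (Fin n ⊕ Fin n) → ℂ := (mg.hessQ θ V).map ((↑) : ℝ → ℂ) *ᵥ w with hudef
  -- J w = (𝒥 − ℛ) u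
  have hJ : (mg.jacMatrix θ V).map ((↑) : ℝ → ℂ) *ᵥ w
      = (mg.phJ - mg.phR V).map ((↑) : ℝ → ℂ) *ᵥ u := by
    rw [mg.jacMatrix_eq_pH θ V hkP hτP hkQ hV, hudef, Matrix.mulVec_mulVec]
    congr 1
    ext a b
    simp only [Matrix.map_apply, Matrix.mul_apply]
    push_cast
    rfl
  -- (𝒬 w)* r = 0, from 𝒬 r = 0 and symmetry
  have hQr : (mg.hessQ θ V).map ((↑) : ℝ → ℂ) *ᵥ (fun k => (r k : ℂ)) = 0 := by
    have h := mg.hessQ_mulVec_rotation θ V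
    funext k
    rw [map_ofReal_mulVec_apply]
    have hk := congr_fun h k
    simp only [Matrix.mulVec, dotProduct, Pi.zero_apply] at hk
    have : (∑ j, ((mg.hessQ θ V k j : ℝ) : ℂ) * (r j : ℂ)) = ((∑ j, mg.hessQ θ V k j * r j : ℝ) : ℂ) := by
      push_cast; rfl
    rw [this, hk]; simp
  have hur : star u ⬝ᵥ (fun k => (r k : ℂ)) = 0 := by
    -- u* r = (𝒬w)* r = w* (𝒬 r) = 0 using symmetry of 𝒬
    have h1 : star u ⬝ᵥ (fun k => (r k : ℂ)) = star w ⬝ᵥ ((mg.hessQ θ V).map ((↑) : ℝ → ℂ) *ᵥ fun k => (r k : ℂ)) := by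
      rw [hudef, star_dotProduct_map_mulVec_symm hsymm]
    rw [h1, hQr, dotProduct_zero]
  -- the dissipation identity: u*(𝒥 − ℛ)u = u* r = conj(0) …
  have hkey : star u ⬝ᵥ ((mg.phJ - mg.phR V).map ((↑) : ℝ → ℂ) *ᵥ u) = star u ⬝ᵥ (fun k => (r k : ℂ)) := by
    rw [← hJ, hw]
  have hsplit : (mg.phJ - mg.phR V).map ((↑) : ℝ → ℂ) = mg.phJ.map ((↑) : ℝ → ℂ) - (mg.phR V).map ((↑) : ℝ → ℂ) := by
    ext a b; simp
  rw [hur, hsplit, Matrix.sub_mulVec, dotProduct_sub] at hkey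
  have hJ0 := re_star_dotProduct_skew_eq_zero mg.phJ_transpose u
  have hRpsd := mg.phR_posSemidef V (fun i => (hRP i).le) (fun i => (hRQ i).le)
  have hRC := posSemidef_map_ofReal hRpsd
  have hre := congr_arg Complex.re hkey
  rw [Complex.sub_re, hJ0, Complex.zero_re] at hre
  have hRu0 : star u ⬝ᵥ ((mg.phR V).map ((↑) : ℝ → ℂ) *ᵥ u) = 0 := by
    have hnn := hRC.dotProduct_mulVec_nonneg u
    obtain ⟨hre', him'⟩ := Complex.nonneg_iff.1 hnn
    apply Complex.ext
    · simp only [Complex.zero_re]; linarith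
    · simpa using him'.symm
  have hRu : (mg.phR V).map ((↑) : ℝ → ℂ) *ᵥ u = 0 := (hRC.dotProduct_mulVec_zero_iff u).1 hRu0
  -- components: u_ω = 0, so the angle block of (𝒥 − ℛ)u is 0, but it equals r_θ = 1
  set uθ : Fin n → ℂ := u ∘ Sum.inl
  set uω : Fin n → ℂ := u ∘ Sum.inr ∘ Sum.inl
  set uV : Fin n → ℂ := u ∘ Sum.inr ∘ Sum.inr
  have hu' : u = Sum.elim uθ (Sum.elim uω uV) := by funext k; rcases k with i | i | i <;> rfl
  rw [hu', phR_map_mulVec] at hRu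
  have huω : uω i₀ = 0 := by
    have h := congr_fun hRu (Sum.inr (Sum.inl i₀))
    simp only [Sum.elim_inr, Sum.elim_inl, Pi.zero_apply, mul_eq_zero, Complex.ofReal_eq_zero] at h
    rcases h with h | h
    · exact absurd h (hRP i₀).ne'
    · exact h
  -- angle row i₀ of (𝒥 − ℛ) u: Λ_P · u_ω i₀ = 1
  have hrow := congr_fun hJ (Sum.inl i₀)
  rw [hw, hsplit, Matrix.sub_mulVec, hu', phR_map_mulVec] at hrow
  simp only [hrdef, Sum.elim_inl, Pi.sub_apply, Pi.zero_apply, sub_zero] at hrow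
  -- compute (𝒥 u)_θ i₀ = Λ_P i₀ * uω i₀
  have hJθ : (mg.phJ.map ((↑) : ℝ → ℂ) *ᵥ Sum.elim uθ (Sum.elim uω uV)) (Sum.inl i₀) = (mg.ΛP i₀ : ℂ) * uω i₀ := by
    rw [phJ, block3, Matrix.fromBlocks_map, Matrix.fromCols_map, Matrix.fromRows_map, Matrix.fromBlocks_map,
      Matrix.map_zero _ Complex.ofReal_zero, Matrix.fromBlocks_mulVec, Matrix.fromCols_mulVec]
    simp only [Sum.elim_comp_inl, Sum.elim_comp_inr, Matrix.zero_mulVec, zero_add, add_zero, Sum.elim_inl,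
      map_ofReal_diagonal_mulVec]
  rw [hJθ, huω, mul_zero] at hrow
  norm_num at hrow

end DroopMicrogrid

end Summit.Ventures.GridStability.Models

end
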